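import Literature.Topology.FourManifolds.TrisectionsH23Function
import Literature.Topology.FourManifolds.BoundarySliceMorseLevel
import Literature.Topology.FourManifolds.BoundarySliceMorseBoundary
import Literature.Topology.FourManifolds.FlowFibreMorseData
import Literature.Topology.FourManifolds.FlowFibreMorseAlgebra
import HarnessLib

/-!
# The Morse function of the handlebody `H₂₃`: smoothness, and the critical points off the
# core zones lie on the flat lid over the critical points of the Heegaard function

Topic `Literature/Topology/FourManifolds`; for the fact seat
`provefact-Literature.Topology.FourManifolds.exists_isBalancedGKTrisection` (Gay–Kirby 2016,
Thm. 4 via §4, Lemma 14), continuing `TrisectionsH23Function.lean`.  Everything in this file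
is **proved**; no definitions besides an abbreviation, no named facts.

`F_H = F ∘ ι : H₂₃ → ℝ` (`BeltParams.FH`), the restriction of `F = 1 - α(f - a) + β Ĝ` to the
handlebody `H₂₃ = X₂ ∩ X₃` with its boundary slice atlas (`TriData.bsliceAtlas`, whose link
condition and margin are now those of the tube frame).  Proved here:

* `BeltParams.contMDiff_FH` — `F_H` is smooth;
* `gFun_eq_flowLift_sub`, `mlineDeriv_gFun_ξ_eq_zero`, `isMCriticalPt_gFun_iff` — at hitting
  points the transported Heegaard function `G` is the lift `φ̄ - b` of
  `FlowFibreMorseData.lean` (seat of the flow rule): `dG(ξ) = 0`, and `G` is critical at `x`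
  iff `g` is critical at `λ x`;
* `hasMFDerivAt_M` — the differential of the rounded height,
  `dM = (1 - σ') dG + σ' df`, `σ' = σ_ε'(w)`;
* **`BeltParams.isMCriticalPt_g_of_isMCriticalPt_FH`** — *at a hitting point of `H₂₃` off the
  core zones, if `F_H` is critical then `g` is critical at the landing point and `w > -ε`*
  (Lagrange's condition for the local level function `M`, `BoundarySliceMorseLevel.lean`:
  with `σ' > 0` it forces `dF = -(α'/σ') dM`, whence `(β + α'(1 - σ')/σ') dG = 0`; with
  `σ' = 0` the flow direction, on which `dM = dG = 0 < α' df`, is a contradiction since such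
  points lie below the plateau of `α`);
* `BeltParams.f_eq_c_of_isMCriticalPt_FH` — hence, the critical points of `g` below `b` being
  `2ε` below `b` (`TubeFrame.critgap`), **every such critical point lies on the flat lid**:
  `f = c`, `w ≥ ε`; and conversely (`isMCriticalPt_FH_of_isMCriticalPt_g`) the lid point over a
  critical point of `g` is critical for `F_H` (there `dG = 0` and `α' = 0`, so `F` is critical
  on `X`).

## References

* D. Gay, R. Kirby, *Trisecting 4-manifolds*, Geom. Topol. 20 (2016), §4, Lemma 14. [GayKirby2016]
* J. Milnor, *Morse theory* (1963), §2 (Lagrange multipliers on a level). [Milnor1963]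
* J. Milnor, *Lectures on the h-cobordism theorem* (1965), Thm. 4.1 (projection along
  trajectories). [MilnorHCobordism1965]
-/

open scoped Manifold ContDiff Topology
open Set Function Filter

noncomputable section

universe u

namespace Literature.Topology.FourManifolds

open Flow

variable {X : Type u} [TopologicalSpace X] [T2Space X] [CompactSpace X]
  [ChartedSpace (EuclideanSpace ℝ (Fin 4)) X] [IsManifold (𝓡 4) ∞ X]

namespace BiCollar

variable {B : BiCollar X}

/-! ### `G` is the lift `φ̄ - b` at hitting points -/

/-- At a hitting point, `λ̃ x` is the level point `π x` of `FlowFibreMorseData.lean`. [folklore] -/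
theorem lamLift_eq_of_hit {x : X} (hx : B.Hit x) :
    B.lamLift x = ⟨levelProj B.U.contMDiff B.f B.a x, apply_levelProj B.U.contMDiff hx⟩ :=
  Subtype.ext (B.incl_lamLift hx)

/-- **At hitting points, `G = φ̄ - b`** for the lift `φ̄ = flowLift` of `g`. [cite: MilnorHCobordism1965, Thm. 4.1] -/
theorem gFun_eq_flowLift_sub {x : X} (hx : B.Hit x) :
    B.gFun x = flowLift B.U.contMDiff B.hf B.g x - B.b := by
  rw [gFun, flowLift_of_hits B.g hx, B.lamLift_eq_of_hit hx]

variable (Fr : B.MorseFrame)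

include Fr in
/-- Near a hitting point, `G = φ̄ - b`. [folklore] -/
theorem gFun_eventuallyEq {x : X} (hx : B.Hit x) :
    B.gFun =ᶠ[𝓝 x] fun y => flowLift B.U.contMDiff B.hf B.g y - B.b := by
  filter_upwards [Fr.isOpen_setOf_hit.mem_nhds hx] with y hy
  exact B.gFun_eq_flowLift_sub hy

include Fr in
/-- **`G` is critical at a hitting point `x` iff `g` is critical at `λ x`** (in a chart: the
derivatives of `G ∘ e⁻¹` and `φ̄ ∘ e⁻¹` agree, and `φ̄` is critical iff `φ` is at the level
point, `isMCriticalPt_flowLift_iff`). [cite: MilnorHCobordism1965, Thm. 4.1] -/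
theorem isMCriticalPt_gFun_iff {x : X} (hx : B.Hit x) :
    IsMCriticalPt (𝓡 4) B.gFun x ↔ IsMCriticalPt (𝓡 3) B.g (B.lamLift x) := by
  set e := chartAt (EuclideanSpace ℝ (Fin 4)) x with he
  have heatlas : e ∈ IsManifold.maximalAtlas (𝓡 4) ∞ X := IsManifold.chart_mem_maximalAtlas x
  have he2 : e ∈ IsManifold.maximalAtlas (𝓡 4) 2 X := IsManifold.maximalAtlas_subset_of_le (by norm_cast) heatlas
  have hxe : x ∈ e.source := mem_chart_source _ x
  have hG2 : ContMDiffAt (𝓡 4) 𝓘(ℝ, ℝ) 2 B.gFun x := (Fr.contMDiffAt_gFun hx).of_le (by norm_cast)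
  have hL2 : ContMDiffAt (𝓡 4) 𝓘(ℝ, ℝ) 2 (flowLift B.U.contMDiff B.hf B.g) x :=
    (contMDiffAt_flowLift Fr.isGradientLike Fr.isMorse B.V.contMDiff_f hx).of_le (by norm_cast)
  rw [isMCriticalPt_iff_fderiv_comp_extend_symm_eq_zero hG2 he2 hxe]
  -- the two functions read in the chart differ by the constant `b` near `e x`
  have hcont : ContinuousAt (e.extend (𝓡 4)).symm (e.extend (𝓡 4) x) := e.continuousAt_extend_symm hxe
  have hlim : Tendsto (e.extend (𝓡 4)).symm (𝓝 (e.extend (𝓡 4) x)) (𝓝 x) := by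
    have h := hcont.tendsto
    rwa [e.extend_left_inv hxe] at h
  have hev : (B.gFun ∘ (e.extend (𝓡 4)).symm) =ᶠ[𝓝 (e.extend (𝓡 4) x)]
      fun u => (flowLift B.U.contMDiff B.hf B.g ∘ (e.extend (𝓡 4)).symm) u - B.b :=
    hlim.eventually (B.gFun_eventuallyEq Fr hx)
  rw [hev.fderiv_eq, fderiv_sub_const, ← isMCriticalPt_iff_fderiv_comp_extend_symm_eq_zero hL2 he2 hxe,
    isMCriticalPt_flowLift_iff Fr.isGradientLike Fr.isMorse B.V.contMDiff_f hx, B.lamLift_eq_of_hit hx]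

/-! ### Chart derivatives of `G`, `f`, `M` at a hitting point -/

namespace MorseFrame

variable {e : OpenPartialHomeomorph X (EuclideanSpace ℝ (Fin 4))}
  (he : e ∈ IsManifold.maximalAtlas (𝓡 4) ∞ X) {x : X} (hxe : x ∈ e.source) (hx : B.Hit x)

include Fr he hxe hx in
/-- `G ∘ e⁻¹` is differentiable at `e x`. [folklore] -/
theorem differentiableAt_gFun_comp_symm : DifferentiableAt ℝ (B.gFun ∘ e.symm) (e x) := by
  have he2 : e ∈ IsManifold.maximalAtlas (𝓡 4) 2 X := IsManifold.maximalAtlas_subset_of_le (by norm_cast) he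
  have h := contDiffAt_comp_extend_symm ((Fr.contMDiffAt_gFun hx).of_le (by norm_cast)) he2 hxe
  simp only [OpenPartialHomeomorph.extend_coe, OpenPartialHomeomorph.extend_coe_symm,
    modelWithCornersSelf_coe, modelWithCornersSelf_coe_symm, CompTriple.comp_eq] at h
  exact h.differentiableAt (by norm_num)

omit [T2Space X] [CompactSpace X] in
include Fr he hxe in
/-- `f ∘ e⁻¹` is differentiable at `e x`. [folklore] -/
theorem differentiableAt_f_comp_symm : DifferentiableAt ℝ (B.f ∘ e.symm) (e x) :=
  differentiableAt_comp_symm_of_isMorse Fr.isMorse he hxe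

include Fr he hxe hx in
/-- **`D(G ∘ e⁻¹)(ξ̂) = 0`**, `ξ̂ = dê(U.ξ x)` (`G` is constant along the flow). [cite: MilnorHCobordism1965, Thm. 4.1] -/
theorem fderiv_gFun_comp_symm_ξ :
    fderiv ℝ (B.gFun ∘ e.symm) (e x) (mfderiv (𝓡 4) 𝓘(ℝ, EuclideanSpace ℝ (Fin 4)) (e.extend (𝓡 4)) x (B.U.ξ x)) = 0 := by
  refine fderiv_comp_symm_apply_eq_of_hasDerivAt (hξ := B.U.contMDiff) he hxe
    (Fr.differentiableAt_gFun_comp_symm he hxe hx) ?_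
  have hfun : B.gFun ∘ flow B.U.contMDiff x = fun _ => B.gFun x := funext fun t => Fr.gFun_fl hx t
  rw [hfun]
  exact hasDerivAt_const 0 _

include Fr he hxe in
/-- **`D(f ∘ e⁻¹)(ξ̂) = ξ(f)`**. [cite: MilnorHCobordism1965, Def. 3.1] -/
theorem fderiv_f_comp_symm_ξ :
    fderiv ℝ (B.f ∘ e.symm) (e x) (mfderiv (𝓡 4) 𝓘(ℝ, EuclideanSpace ℝ (Fin 4)) (e.extend (𝓡 4)) x (B.U.ξ x)) =
      mlineDeriv (𝓡 4) B.f x (B.U.ξ x) :=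
  fderiv_comp_symm_apply_eq_mlineDeriv (hξ := B.U.contMDiff) Fr.isMorse he hxe

end MorseFrame

namespace TriData

variable {Fr} (T : B.TriData)

section ChartDerivs

variable {e : OpenPartialHomeomorph X (EuclideanSpace ℝ (Fin 4))}
  (he : e ∈ IsManifold.maximalAtlas (𝓡 4) ∞ X) {x : X} (hxe : x ∈ e.source) (hx : B.Hit x)

/-- The two-variable form of the rounded height: `Γ_M(s, t) = s + σ_ε(t - c - s)`. [folklore] -/
def ΓM (q : ℝ × ℝ) : ℝ := q.1 + creaseσ T.ε (q.2 - T.c - q.1)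

omit [T2Space X] [CompactSpace X] in
/-- The partial derivatives of `Γ_M`: `∂₁ = 1 - σ'`, `∂₂ = σ'`, `σ' = σ_ε'(t - c - s)`. [folklore] -/
theorem partials_ΓM (s t : ℝ) :
    partialFst T.ΓM (s, t) = 1 - creaseStep ((t - T.c - s) / T.ε) ∧
      partialSnd T.ΓM (s, t) = creaseStep ((t - T.c - s) / T.ε) := by
  have h1 : HasFDerivAt (fun q : ℝ × ℝ => q.1) (ContinuousLinearMap.fst ℝ ℝ ℝ) (s, t) := hasFDerivAt_fst
  have h2 : HasFDerivAt (fun q : ℝ × ℝ => q.2 - T.c - q.1)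
      (ContinuousLinearMap.snd ℝ ℝ ℝ - ContinuousLinearMap.fst ℝ ℝ ℝ) (s, t) :=
    (hasFDerivAt_snd.sub_const T.c).sub hasFDerivAt_fst
  have h3 := (hasDerivAt_creaseσ T.ε_pos (t - T.c - s)).comp_hasFDerivAt (s, t) h2
  have h : HasFDerivAt T.ΓM (ContinuousLinearMap.fst ℝ ℝ ℝ +
      creaseStep ((t - T.c - s) / T.ε) • (ContinuousLinearMap.snd ℝ ℝ ℝ - ContinuousLinearMap.fst ℝ ℝ ℝ)) (s, t) :=
    h1.add h3
  simp only [partialFst, partialSnd, h.fderiv]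
  constructor <;> (simp only [_root_.add_apply, _root_.smul_apply, _root_.sub_apply,
    ContinuousLinearMap.coe_fst', ContinuousLinearMap.coe_snd', smul_eq_mul]; ring)

include he hxe hx in
/-- **`D(M ∘ e⁻¹)_(e x)(v) = (1 - σ') D(G ∘ e⁻¹)(v) + σ' D(f ∘ e⁻¹)(v)`**, `σ' = σ_ε'(w x)`. [cite: GayKirby2016, §4, Lemma 14] -/
theorem fderiv_M_comp_symm_apply (v : EuclideanSpace ℝ (Fin 4)) :
    fderiv ℝ (T.M ∘ e.symm) (e x) v =
      (1 - creaseStep (T.w x / T.ε)) * fderiv ℝ (B.gFun ∘ e.symm) (e x) v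
        + creaseStep (T.w x / T.ε) * fderiv ℝ (B.f ∘ e.symm) (e x) v := by
  have hfun : T.M ∘ e.symm = fun u => T.ΓM ((B.gFun ∘ e.symm) u, (B.f ∘ e.symm) u) := rfl
  have hΓ : DifferentiableAt ℝ T.ΓM ((B.gFun ∘ e.symm) (e x), (B.f ∘ e.symm) (e x)) := by
    have : ContDiff ℝ ∞ T.ΓM :=
      (contDiff_fst).add ((contDiff_creaseσ T.ε).comp ((contDiff_snd.sub contDiff_const).sub contDiff_fst))
    exact this.differentiable (by simp) _
  rw [hfun, fderiv_comp₂_apply hΓ (T.Fr.differentiableAt_gFun_comp_symm he hxe hx) (T.Fr.differentiableAt_f_comp_symm he hxe)]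
  obtain ⟨h1, h2⟩ := T.partials_ΓM ((B.gFun ∘ e.symm) (e x)) ((B.f ∘ e.symm) (e x))
  rw [h1, h2]
  have hw : (B.f ∘ e.symm) (e x) - T.c - (B.gFun ∘ e.symm) (e x) = T.w x := by
    simp only [comp_apply, e.left_inv hxe]; rfl
  rw [hw]

end ChartDerivs

/-! ### Points of `H₂₃` off `X₁` lie above the level `a`; the box chart -/

/-- **On `H₂₃`, off `X₁`, `f > a`** (at a hitting point: if `w > -ε` then
`f = c + w - σ_ε(w) > c - 2ε ≥ a + δ`; if `w ≤ -ε` then `G = 0`, so `θ = 0` and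
`F₁ = s > 0`). [cite: GayKirby2016, §4, Lemma 14] -/
theorem a_lt_f_of_mem_H₂₃ (hc2 : B.a + B.U.δ + 2 * T.ε ≤ T.c) {x : X} (hx : x ∈ T.H₂₃) (hh : B.Hit x)
    (hx₁ : x ∉ T.X₁) : B.a < B.f x := by
  have h0 : T.M x = 0 := T.M_eq_zero_of_mem_H₂₃ hx hh
  have hM : T.M x = B.gFun x + creaseσ T.ε (T.w x) := rfl
  have hw : T.w x = B.f x - T.c - B.gFun x := rfl
  have hδ := B.U.δ_pos
  have hε := T.ε_pos
  rcases lt_or_ge (-T.ε) (T.w x) with hlt | hle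
  · have hσ := creaseσ_le T.ε_pos (T.w x)
    rcases le_total (T.w x) 0 with h | h
    · rw [max_eq_right h] at hσ; linarith
    · rw [max_eq_left h] at hσ; linarith
  · have hG : B.gFun x = 0 := T.gFun_eq_zero_of_M_eq_zero h0 hle
    have hθ : T.D.θ x = 0 := by
      by_cases hs : |B.sFun x| < B.U.δ
      · have hr : B.rFun x = 0 := by rw [← T.Fr.gFun_eq_rFun (B.mem_band_U hs)]; exact hG
        exact T.D.θ_eq_zero_of_rFun_eq_zero hr
      · exact T.D.θ_eq_zero_of_le (by push Not at hs; linarith [T.D.rOut₁_lt])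
    have hF₁ : ¬ (T.D.F₁ x ≤ 0) := hx₁
    rw [BevelData.F₁, hθ, mul_zero, add_zero] at hF₁
    have : 0 < B.sFun x := lt_of_not_ge hF₁
    have hs : B.sFun x = B.f x - B.a := rfl
    linarith

/-- Coordinate `3` of the box chart is `r`. [folklore] -/
theorem boxSlice_apply_three (p q : X) : (T.boxSlice p).Θ q 3 = B.rFun q := by
  rw [boxSlice, BoundarySliceChart.ofEquiv_apply, wedgeChart_apply, swap13_apply_three, wedgeFun_apply_one,
    vFun_frame₀]

namespace TubeFrame

namespace BeltParams

variable {T} {ι : Type} [Fintype ι] {𝔉 : T.TubeFrame ι} (𝔓 : 𝔉.BeltParams)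
  (hc2 : B.a + B.U.δ + 2 * T.ε ≤ T.c)

/-- **The Morse function of the handlebody** `F_H = F ∘ ι : H₂₃ → ℝ`. [cite: GayKirby2016, §4, Lemma 14] -/
abbrev FH : T.H₂₃ → ℝ := 𝔓.Famb ∘ Subtype.val

/-- **`F_H` is smooth** (for the structure `bsliceAtlas`). [cite: GayKirby2016, §4, Lemma 14] -/
theorem contMDiff_FH :
    letI := (T.bsliceAtlas hc2 𝔉.two_mul_ε_le 𝔉.linkCondition).chartedSpace
    ContMDiff (𝓡∂ 3) 𝓘(ℝ, ℝ) ∞ 𝔓.FH := by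
  letI := (T.bsliceAtlas hc2 𝔉.two_mul_ε_le 𝔉.linkCondition).chartedSpace
  intro p
  exact (𝔓.contMDiffAt_Famb_of_mem_H₂₃ hc2 p.2).comp p
    ((T.bsliceAtlas hc2 𝔉.two_mul_ε_le 𝔉.linkCondition).contMDiff_subtype_val p)

/-! ### On the bi-collar box: `F = 1 - α(s) + β r` -/

/-- **On the box, `F = 1 - α(s) + β r`** (no core zone meets the box, and `G = r` there). [cite: GayKirby2016, §4, Lemma 14] -/
theorem Famb_of_mem_box {x : X} (hx : x ∈ B.box T.D.εw) :
    𝔓.Famb x = 1 - T.alpha (B.sFun x) + 𝔓.β * B.rFun x := by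
  rw [Famb, 𝔓.Ghat_of_forall_not_mem (𝔓.not_mem_zone_of_mem_box hx), T.gFun_eq_rFun_of_mem_box hx]
  rfl

/-- **`F` read in the box chart**: `F ∘ Θ⁻¹ (z) = 1 - α(z₀) + β z₃` on the target of the box
chart `Θ`. [cite: GayKirby2016, §4, Lemma 14] -/
theorem Famb_comp_boxSlice_symm_apply (p : X) {z : EuclideanSpace ℝ (Fin 4)} (hz : z ∈ (T.boxSlice p).Θ.target) :
    (𝔓.Famb ∘ (T.boxSlice p).Θ.symm) z = 1 - T.alpha (z 0) + 𝔓.β * z 3 := by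
  have hq : (T.boxSlice p).Θ.symm z ∈ (T.boxSlice p).Θ.source := (T.boxSlice p).Θ.map_target hz
  have hqb : (T.boxSlice p).Θ.symm z ∈ B.box T.D.εw := T.boxSlice_source_subset p hq
  rw [comp_apply, 𝔓.Famb_of_mem_box hqb, ← T.boxSlice_apply_zero p ((T.boxSlice p).Θ.symm z),
    ← T.boxSlice_apply_three p ((T.boxSlice p).Θ.symm z), (T.boxSlice p).Θ.right_inv hz]

omit [T2Space X] [CompactSpace X] in
/-- The derivative of the model `z ↦ 1 - α(z₀) + β z₃`. [folklore] -/
theorem hasFDerivAt_boxModel (z : EuclideanSpace ℝ (Fin 4)) :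
    HasFDerivAt (fun z : EuclideanSpace ℝ (Fin 4) =>
        1 - T.alpha ((EuclideanSpace.proj (0 : Fin 4) : EuclideanSpace ℝ (Fin 4) →L[ℝ] ℝ) z)
          + 𝔓.β * (EuclideanSpace.proj (3 : Fin 4) : EuclideanSpace ℝ (Fin 4) →L[ℝ] ℝ) z)
      ((0 : EuclideanSpace ℝ (Fin 4) →L[ℝ] ℝ)
        - deriv T.alpha (z 0) • (EuclideanSpace.proj (0 : Fin 4) : EuclideanSpace ℝ (Fin 4) →L[ℝ] ℝ)
        + 𝔓.β • (EuclideanSpace.proj (3 : Fin 4) : EuclideanSpace ℝ (Fin 4) →L[ℝ] ℝ)) z := by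
  set P0 := (EuclideanSpace.proj (0 : Fin 4) : EuclideanSpace ℝ (Fin 4) →L[ℝ] ℝ) with hP0
  set P3 := (EuclideanSpace.proj (3 : Fin 4) : EuclideanSpace ℝ (Fin 4) →L[ℝ] ℝ) with hP3
  have h0 : HasFDerivAt (⇑P0) P0 z := P0.hasFDerivAt
  have h3 : HasFDerivAt (⇑P3) P3 z := P3.hasFDerivAt
  have hα := (((T.contDiff_alpha.differentiable (by simp)) (P0 z)).hasDerivAt).comp_hasFDerivAt z h0
  exact ((hasFDerivAt_const (1 : ℝ) z).sub hα).add (h3.const_mul 𝔓.β)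

/-- **The derivative of `F` in the box chart**: `D(F ∘ Θ⁻¹)(z) v = -α'(z₀) v₀ + β v₃`. [cite: GayKirby2016, §4, Lemma 14] -/
theorem fderiv_Famb_comp_boxSlice_symm_apply (p : X) {z : EuclideanSpace ℝ (Fin 4)}
    (hz : z ∈ (T.boxSlice p).Θ.target) (v : EuclideanSpace ℝ (Fin 4)) :
    fderiv ℝ (𝔓.Famb ∘ (T.boxSlice p).Θ.symm) z v = -deriv T.alpha (z 0) * v 0 + 𝔓.β * v 3 := by
  have hev : (𝔓.Famb ∘ (T.boxSlice p).Θ.symm) =ᶠ[𝓝 z] fun z : EuclideanSpace ℝ (Fin 4) =>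
      1 - T.alpha ((EuclideanSpace.proj (0 : Fin 4) : EuclideanSpace ℝ (Fin 4) →L[ℝ] ℝ) z)
        + 𝔓.β * (EuclideanSpace.proj (3 : Fin 4) : EuclideanSpace ℝ (Fin 4) →L[ℝ] ℝ) z := by
    filter_upwards [(T.boxSlice p).Θ.open_target.mem_nhds hz] with y hy
    exact 𝔓.Famb_comp_boxSlice_symm_apply p hy
  rw [hev.fderiv_eq, (𝔓.hasFDerivAt_boxModel z).fderiv]
  simp only [_root_.add_apply, _root_.sub_apply, _root_.zero_apply, _root_.smul_apply, smul_eq_mul]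
  rw [show (EuclideanSpace.proj (0 : Fin 4) : EuclideanSpace ℝ (Fin 4) →L[ℝ] ℝ) v = v 0 from rfl,
    show (EuclideanSpace.proj (3 : Fin 4) : EuclideanSpace ℝ (Fin 4) →L[ℝ] ℝ) v = v 3 from rfl]
  ring

include hc2 in
/-- **On the box, `F_H` has no critical points** (there `H₂₃ = {r = 0, s ≥ 0}`, `F_H = 1 - α(s)`
and `α'(s) > 0` for `s < ε_w`; the inward normal `e₀` of the box chart detects it, also at the
boundary points `s = 0`). [cite: GayKirby2016, §4, Lemma 14] [cite: MilnorHCobordism1965, Def. 3.1] -/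
theorem not_isMCriticalPt_FH_of_mem_box {p : T.H₂₃} (hb : p.1 ∈ B.box T.D.εw) :
    letI := (T.bsliceAtlas hc2 𝔉.two_mul_ε_le 𝔉.linkCondition).chartedSpace
    ¬ IsMCriticalPt (𝓡∂ 3) 𝔓.FH p := by
  letI := (T.bsliceAtlas hc2 𝔉.two_mul_ε_le 𝔉.linkCondition).chartedSpace
  have hD := T.bsliceAtlas_datum_of_mem_box hc2 𝔉.two_mul_ε_le 𝔉.linkCondition p hb
  have hF : ContMDiffAt (𝓡 4) 𝓘(ℝ, ℝ) 2 𝔓.Famb p.1 := (𝔓.contMDiffAt_Famb_of_mem_H₂₃ hc2 p.2).of_le (by norm_cast)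
  refine (T.bsliceAtlas hc2 𝔉.two_mul_ε_le 𝔉.linkCondition).not_isMCriticalPt_comp_val_of_datum_eq hD hF
    (u := PiLp.single 2 (0 : Fin 3) (1 : ℝ)) ?_
  have hp : p.1 ∈ (T.boxSlice p.1).Θ.source := T.mem_boxSlice_source hb
  rw [𝔓.fderiv_Famb_comp_boxSlice_symm_apply p.1 ((T.boxSlice p.1).Θ.map_source hp), T.boxSlice_apply_zero]
  have h0 : (sliceInl 3 (PiLp.single 2 (0 : Fin 3) (1 : ℝ))) 0 = 1 := by
    rw [← dropLast_apply_zero, sliceInl_apply, dropLast_snocEquiv, PiLp.single_apply, if_pos rfl]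
  have h3 : (sliceInl 3 (PiLp.single 2 (0 : Fin 3) (1 : ℝ))) 3 = 0 := sliceInl_apply_last 3 _
  rw [h0, h3, mul_one, mul_zero, add_zero, neg_ne_zero]
  apply ne_of_gt
  apply T.deriv_alpha_pos
  have hs : B.sFun p.1 < T.D.εw := (abs_lt.1 hb.1).2
  have := T.D.εw_le_δU
  have := T.ε_pos
  unfold αS ασ
  linarith

/-- **`F_H = 1` on the boundary** (the central surface: `s = r = 0`, `α(0) = 0`). [cite: GayKirby2016, §4, Lemma 14] -/
theorem FH_eq_one_of_mem_surface {p : T.H₂₃} (hps : p.1 ∈ B.surface) : 𝔓.FH p = 1 := by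
  obtain ⟨hs, hr⟩ := (B.mem_surface_iff p.1).1 hps
  show 𝔓.Famb p.1 = 1
  rw [𝔓.Famb_of_mem_box (B.mem_box_of_mem_surface T.D.εw_pos hps), hs, hr, T.alpha_zero]
  ring

include hc2 in
/-- **`F_H < 1` off the boundary** (on the box `F_H = 1 - α(s)` with `s > 0`; on a core zone
`F < 1` by `Famb_lt_one_of_mem_zone`; elsewhere the point hits, `G = -σ_ε(w) ≤ 0` and
`α(f - a) > 0` since `f > a`). [cite: GayKirby2016, §4, Lemma 14] -/
theorem FH_lt_one_of_not_mem_surface {p : T.H₂₃} (hps : p.1 ∉ B.surface) : 𝔓.FH p < 1 := by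
  show 𝔓.Famb p.1 < 1
  have hβ := 𝔓.β_pos
  by_cases hb : p.1 ∈ B.box T.D.εw
  · obtain ⟨hr, hs⟩ := (T.mem_H₂₃_iff_of_mem_box hb).1 p.2
    have hs0 : B.sFun p.1 ≠ 0 := fun h => hps ((B.mem_surface_iff p.1).2 ⟨h, hr⟩)
    have hpos : 0 < T.alpha (B.sFun p.1) := T.alpha_pos (lt_of_le_of_ne hs (Ne.symm hs0))
    rw [𝔓.Famb_of_mem_box hb, hr]
    linarith
  · have hp₁ : p.1 ∉ T.X₁ := T.not_mem_X₁_of_mem_H₂₃_of_not_mem_box hc2 p.2 hb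
    by_cases hz : ∃ j, p.1 ∈ 𝔓.zone j
    · obtain ⟨j, hj⟩ := hz
      exact 𝔓.Famb_lt_one_of_mem_zone hj
    · push Not at hz
      have hh : B.Hit p.1 := by
        by_contra hh
        obtain ⟨j, hj, -⟩ := 𝔓.exists_mem_zone_of_not_hit p.2 hp₁ hh
        exact hz j hj
      have h0 : T.M p.1 = 0 := T.M_eq_zero_of_mem_H₂₃ p.2 hh
      have hM : T.M p.1 = B.gFun p.1 + creaseσ T.ε (T.w p.1) := rfl
      have hG : B.gFun p.1 ≤ 0 := by linarith [creaseσ_nonneg T.ε_pos (T.w p.1)]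
      have hα : 0 < T.alpha (B.f p.1 - B.a) := T.alpha_pos (by linarith [T.a_lt_f_of_mem_H₂₃ hc2 p.2 hh hp₁])
      rw [Famb, 𝔓.Ghat_of_forall_not_mem hz]
      nlinarith

/-! ### The critical points off the core zones -/

/-- The un-modified ambient function near a hitting point off the zones. [folklore] -/
def Flin (x : X) : ℝ := 1 - T.alpha (B.f x - B.a) + 𝔓.β * B.gFun x

/-- Off the zones, near a point of `H₂₃ ∖ X₁`, `F = F_lin`. [folklore] -/
theorem Famb_eventuallyEq_Flin {p : X} (hH : p ∈ T.H₂₃) (hp₁ : p ∉ T.X₁) (hz : ∀ j, p ∉ 𝔓.zone j) :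
    𝔓.Famb =ᶠ[𝓝 p] 𝔓.Flin := by
  filter_upwards [𝔓.Ghat_eventuallyEq_gFun hH hp₁ hz] with x hx
  simp only [Famb, Flin, hx]

/-- `F_lin` is smooth at hitting points. [folklore] -/
theorem contMDiffAt_Flin {x : X} (hx : B.Hit x) : ContMDiffAt (𝓡 4) 𝓘(ℝ, ℝ) ∞ 𝔓.Flin x := by
  have hf : ContMDiffAt (𝓡 4) 𝓘(ℝ, ℝ) ∞ (fun x => B.f x - B.a) x :=
    B.U.contMDiff_f.contMDiffAt.sub contMDiffAt_const
  exact (contMDiffAt_const.sub (T.contDiff_alpha.contMDiff.contMDiffAt.comp x hf)).add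
    (contMDiffAt_const.mul (T.Fr.contMDiffAt_gFun hx))

/-- The two-variable form of `F_lin`: `Γ_F(s, t) = 1 - α(t - a) + β s`. [folklore] -/
def ΓF (q : ℝ × ℝ) : ℝ := 1 - T.alpha (q.2 - B.a) + 𝔓.β * q.1

omit [T2Space X] [CompactSpace X] in
/-- The partial derivatives of `Γ_F`: `∂₁ = β`, `∂₂ = -α'(t - a)`. [folklore] -/
theorem partials_ΓF (s t : ℝ) :
    partialFst 𝔓.ΓF (s, t) = 𝔓.β ∧ partialSnd 𝔓.ΓF (s, t) = -deriv T.alpha (t - B.a) := by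
  have h1 : HasFDerivAt (fun q : ℝ × ℝ => 𝔓.β * q.1) (𝔓.β • ContinuousLinearMap.fst ℝ ℝ ℝ) (s, t) :=
    hasFDerivAt_fst.const_mul 𝔓.β
  have h2 : HasFDerivAt (fun q : ℝ × ℝ => q.2 - B.a) (ContinuousLinearMap.snd ℝ ℝ ℝ) (s, t) :=
    hasFDerivAt_snd.sub_const B.a
  have h3 := (((T.contDiff_alpha.differentiable (by simp)) (t - B.a)).hasDerivAt).comp_hasFDerivAt (s, t) h2
  have h : HasFDerivAt 𝔓.ΓF ((0 : ℝ × ℝ →L[ℝ] ℝ) - deriv T.alpha (t - B.a) • ContinuousLinearMap.snd ℝ ℝ ℝ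
      + 𝔓.β • ContinuousLinearMap.fst ℝ ℝ ℝ) (s, t) :=
    ((hasFDerivAt_const (1 : ℝ) (s, t)).sub h3).add h1
  simp only [partialFst, partialSnd, h.fderiv]
  constructor <;> (simp only [_root_.add_apply, _root_.smul_apply, _root_.sub_apply, _root_.zero_apply,
    ContinuousLinearMap.coe_fst', ContinuousLinearMap.coe_snd', smul_eq_mul]; ring)

/-- **`D(F_lin ∘ e⁻¹)_(e x)(v) = β D(G ∘ e⁻¹)(v) - α'(f x - a) D(f ∘ e⁻¹)(v)`**. [folklore] -/
theorem fderiv_Flin_comp_symm_apply {e : OpenPartialHomeomorph X (EuclideanSpace ℝ (Fin 4))}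
    (he : e ∈ IsManifold.maximalAtlas (𝓡 4) ∞ X) {x : X} (hxe : x ∈ e.source) (hx : B.Hit x)
    (v : EuclideanSpace ℝ (Fin 4)) :
    fderiv ℝ (𝔓.Flin ∘ e.symm) (e x) v =
      𝔓.β * fderiv ℝ (B.gFun ∘ e.symm) (e x) v - deriv T.alpha (B.f x - B.a) * fderiv ℝ (B.f ∘ e.symm) (e x) v := by
  have hfun : 𝔓.Flin ∘ e.symm = fun u => 𝔓.ΓF ((B.gFun ∘ e.symm) u, (B.f ∘ e.symm) u) := by
    funext u; simp only [comp_apply, Flin, ΓF]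
  have hΓ : DifferentiableAt ℝ 𝔓.ΓF ((B.gFun ∘ e.symm) (e x), (B.f ∘ e.symm) (e x)) := by
    have : ContDiff ℝ ∞ 𝔓.ΓF :=
      (contDiff_const.sub (T.contDiff_alpha.comp (contDiff_snd.sub contDiff_const))).add (contDiff_const.mul contDiff_fst)
    exact this.differentiable (by simp) _
  rw [hfun, fderiv_comp₂_apply hΓ (T.Fr.differentiableAt_gFun_comp_symm he hxe hx) (T.Fr.differentiableAt_f_comp_symm he hxe)]
  obtain ⟨h1, h2⟩ := 𝔓.partials_ΓF ((B.gFun ∘ e.symm) (e x)) ((B.f ∘ e.symm) (e x))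
  rw [h1, h2]
  have hf : (B.f ∘ e.symm) (e x) = B.f x := by simp only [comp_apply, e.left_inv hxe]
  rw [hf]
  ring

include hc2 in
/-- **At a hitting point of `H₂₃` off the core zones, a critical point of `F_H` lies over a
critical point of `g`, with `w > -ε`.**  (Lagrange's condition for the local level function
`M`, read in a chart: with `σ' > 0`, testing on `v - t ξ̂` with `dM(v - tξ̂) = 0` gives
`(βσ' + α'(1 - σ')) dG(v) = 0`; with `σ' = 0`, testing on `ξ̂` gives `α' ξ(f) = 0`,
impossible below the plateau of `α`.) [cite: GayKirby2016, §4, Lemma 14] [cite: Milnor1963, §2] -/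
theorem isMCriticalPt_g_of_isMCriticalPt_FH {p : T.H₂₃}
    (hps : p.1 ∉ B.surface) (hh : B.Hit p.1) (hz : ∀ j, p.1 ∉ 𝔓.zone j)
    (hcrit : letI := (T.bsliceAtlas hc2 𝔉.two_mul_ε_le 𝔉.linkCondition).chartedSpace
      IsMCriticalPt (𝓡∂ 3) 𝔓.FH p) :
    IsMCriticalPt (𝓡 3) B.g (B.lamLift p.1) ∧ -T.ε < T.w p.1 := by
  letI := (T.bsliceAtlas hc2 𝔉.two_mul_ε_le 𝔉.linkCondition).chartedSpace
  set Φ := T.bsliceAtlas hc2 𝔉.two_mul_ε_le 𝔉.linkCondition with hΦ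
  have hp₁ : p.1 ∉ T.X₁ := fun h1 => hps (by rw [← T.H₂₃_inter_X₁ hc2]; exact ⟨p.2, h1⟩)
  have h0 : T.M p.1 = 0 := T.M_eq_zero_of_mem_H₂₃ p.2 hh
  have hint : (𝓡∂ 3).IsInteriorPoint p := by
    rw [ModelWithCorners.isInteriorPoint_iff_not_isBoundaryPoint,
      T.isBoundaryPoint_iff_mem_surface hc2 𝔉.two_mul_ε_le 𝔉.linkCondition p]
    exact hps
  -- `F_H` is critical iff `F_lin|H` is
  have hev : 𝔓.Famb =ᶠ[𝓝 p.1] 𝔓.Flin := 𝔓.Famb_eventuallyEq_Flin p.2 hp₁ hz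
  have hev' : (𝔓.Famb ∘ Subtype.val) =ᶠ[𝓝 p] (𝔓.Flin ∘ Subtype.val) :=
    (continuous_subtype_val.continuousAt (x := p)).eventually hev
  have hcrit' : IsMCriticalPt (𝓡∂ 3) (𝔓.Flin ∘ Subtype.val) p := by
    unfold IsMCriticalPt at hcrit ⊢
    rwa [hev'.mfderiv_eq] at hcrit
  -- the chart and Lagrange's condition for `ψ = strFun` (`= M` near `p`)
  set e := chartAt (EuclideanSpace ℝ (Fin 4)) p.1 with hedef
  have he : e ∈ IsManifold.maximalAtlas (𝓡 4) ∞ X := IsManifold.chart_mem_maximalAtlas p.1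
  have hpe : p.1 ∈ e.source := mem_chart_source _ p.1
  have hψ := T.contMDiff_strFun hh h0
  have hψc := T.not_isMCriticalPt_strFun hh h0
  have hO := T.isOpen_strDom hh h0
  have hpO := T.mem_strDom hh h0 hp₁
  have hS : ∀ q ∈ T.strDom hh h0, q ∈ T.H₂₃ ↔ T.strFun hh h0 q = T.strFun hh h0 p.1 := fun q hq =>
    T.mem_H₂₃_iff_of_mem_strDom hh h0 hq
  have hL := (Φ.isMCriticalPt_comp_val_iff_of_localLevel hψ hψc hO hpO hS hint
    ((𝔓.contMDiffAt_Flin hh).of_le (by norm_cast)) he hpe).1 hcrit'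
  -- `D(ψ ∘ e⁻¹)(e p) = D(M ∘ e⁻¹)(e p)`
  have hlim : Tendsto e.symm (𝓝 (e p.1)) (𝓝 p.1) := by
    have h := (e.continuousAt_symm (e.map_source hpe)).tendsto
    rwa [e.left_inv hpe] at h
  have hevM : (T.strFun hh h0 ∘ e.symm) =ᶠ[𝓝 (e p.1)] (T.M ∘ e.symm) :=
    hlim.eventually (T.strFun_eventuallyEq hh h0)
  have hψM : fderiv ℝ (T.strFun hh h0 ∘ e.symm) (e p.1) = fderiv ℝ (T.M ∘ e.symm) (e p.1) := hevM.fderiv_eq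
  -- the scalars
  set σ' := creaseStep (T.w p.1 / T.ε) with hσ'
  set α' := deriv T.alpha (B.f p.1 - B.a) with hα'
  set ξv : EuclideanSpace ℝ (Fin 4) := mfderiv (𝓡 4) 𝓘(ℝ, EuclideanSpace ℝ (Fin 4)) (e.extend (𝓡 4)) p.1 (B.U.ξ p.1) with hξv
  set m := mlineDeriv (𝓡 4) B.f p.1 (B.U.ξ p.1) with hm
  have hmpos : 0 < m := T.Fr.isGradientLike.mlineDeriv_pos _ (T.Fr.not_isMCriticalPt_of_hit hh)
  have hσ0 : 0 ≤ σ' := creaseStep_nonneg _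
  have hσ1 : σ' ≤ 1 := creaseStep_le_one _
  have hα0 : 0 ≤ α' := (T.deriv_alpha_mem _).1
  have hGξ : fderiv ℝ (B.gFun ∘ e.symm) (e p.1) ξv = 0 := T.Fr.fderiv_gFun_comp_symm_ξ he hpe hh
  have hfξ : fderiv ℝ (B.f ∘ e.symm) (e p.1) ξv = m := T.Fr.fderiv_f_comp_symm_ξ he hpe
  have hMv : ∀ v, fderiv ℝ (T.strFun hh h0 ∘ e.symm) (e p.1) v =
      (1 - σ') * fderiv ℝ (B.gFun ∘ e.symm) (e p.1) v + σ' * fderiv ℝ (B.f ∘ e.symm) (e p.1) v := fun v => by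
    rw [hψM, T.fderiv_M_comp_symm_apply he hpe hh]
  have hFv : ∀ v, fderiv ℝ (𝔓.Flin ∘ e.symm) (e p.1) v =
      𝔓.β * fderiv ℝ (B.gFun ∘ e.symm) (e p.1) v - α' * fderiv ℝ (B.f ∘ e.symm) (e p.1) v := fun v =>
    𝔓.fderiv_Flin_comp_symm_apply he hpe hh v
  have hβ := 𝔓.β_pos
  rcases hσ0.eq_or_lt with hσ | hσ
  · -- `σ' = 0`: test `ξ̂`
    exfalso
    have h1 : fderiv ℝ (T.strFun hh h0 ∘ e.symm) (e p.1) ξv = 0 := by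
      rw [hMv, hGξ, hfξ, ← hσ]; ring
    have h2 := hL ξv h1
    rw [hFv, hGξ, hfξ] at h2
    have hα'0 : α' = 0 := by nlinarith
    have hw : T.w p.1 ≤ -T.ε := by
      by_contra hw'
      push Not at hw'
      have : 0 < creaseStep (T.w p.1 / T.ε) := creaseStep_pos (by rw [lt_div_iff₀ T.ε_pos]; linarith)
      linarith
    have hG0 : B.gFun p.1 = 0 := T.gFun_eq_zero_of_M_eq_zero h0 hw
    have hfc : B.f p.1 - T.c ≤ -T.ε := by
      have : T.w p.1 = B.f p.1 - T.c - B.gFun p.1 := rfl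
      linarith
    have hpos : 0 < deriv T.alpha (B.f p.1 - B.a) := by
      apply T.deriv_alpha_pos
      have := T.ε_pos
      unfold αS ασ; linarith
    rw [← hα'] at hpos
    linarith
  · -- `σ' > 0`: `D(G ∘ e⁻¹)(e p) = 0`
    have key : ∀ v, fderiv ℝ (B.gFun ∘ e.symm) (e p.1) v = 0 := by
      intro v
      set a := fderiv ℝ (B.gFun ∘ e.symm) (e p.1) v with ha
      set d := fderiv ℝ (B.f ∘ e.symm) (e p.1) v with hd
      have hσm : σ' * m ≠ 0 := mul_ne_zero hσ.ne' hmpos.ne'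
      set t := ((1 - σ') * a + σ' * d) / (σ' * m) with ht
      have htm : t * (σ' * m) = (1 - σ') * a + σ' * d := div_mul_cancel₀ _ hσm
      have hv' : fderiv ℝ (T.strFun hh h0 ∘ e.symm) (e p.1) (v - t • ξv) = 0 := by
        rw [map_sub, map_smul, hMv, hMv, hGξ, hfξ, smul_eq_mul]
        nlinarith [htm]
      have h := hL _ hv'
      rw [map_sub, map_smul, hFv, hFv, hGξ, hfξ, smul_eq_mul] at h
      -- `h : (β a - α' d) - t (β·0 - α' m) = 0`
      have h' : (𝔓.β * σ' + α' * (1 - σ')) * a = 0 := by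
        have hexp : 𝔓.β * a - α' * d + t * (α' * m) = 0 := by linarith
        have : (𝔓.β * a - α' * d) * σ' + α' * (t * (σ' * m)) = 0 := by nlinarith
        rw [htm] at this
        linarith
      have hcoef : 0 < 𝔓.β * σ' + α' * (1 - σ') := by nlinarith
      rcases mul_eq_zero.1 h' with h'' | h''
      · exact absurd h'' hcoef.ne'
      · exact h''
    have hGcrit : IsMCriticalPt (𝓡 4) B.gFun p.1 := by
      have he2 : e ∈ IsManifold.maximalAtlas (𝓡 4) 2 X := IsManifold.maximalAtlas_subset_of_le (by norm_cast) he
      rw [isMCriticalPt_iff_fderiv_comp_extend_symm_eq_zero ((T.Fr.contMDiffAt_gFun hh).of_le (by norm_cast)) he2 hpe]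
      ext v
      simpa [OpenPartialHomeomorph.extend_coe, OpenPartialHomeomorph.extend_coe_symm] using key v
    refine ⟨(B.isMCriticalPt_gFun_iff T.Fr hh).1 hGcrit, ?_⟩
    by_contra hw'
    push Not at hw'
    have : creaseStep (T.w p.1 / T.ε) = 0 := creaseStep_of_le_neg_one (by rw [div_le_iff₀ T.ε_pos]; linarith)
    linarith

include hc2 in
/-- **The critical points of `F_H` off the core zones lie on the flat lid**: at such a (hitting)
critical point, `f = c` and `w ≥ ε` (the critical points of `g` below `b` are `2ε` below `b`,
`TubeFrame.critgap`). [cite: GayKirby2016, §4, Lemma 14] -/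
theorem f_eq_c_of_isMCriticalPt_FH {p : T.H₂₃}
    (hps : p.1 ∉ B.surface) (hh : B.Hit p.1) (hz : ∀ j, p.1 ∉ 𝔓.zone j)
    (hcrit : letI := (T.bsliceAtlas hc2 𝔉.two_mul_ε_le 𝔉.linkCondition).chartedSpace
      IsMCriticalPt (𝓡∂ 3) 𝔓.FH p) :
    B.f p.1 = T.c ∧ T.ε ≤ T.w p.1 := by
  obtain ⟨hcg, hw⟩ := 𝔓.isMCriticalPt_g_of_isMCriticalPt_FH hc2 hps hh hz hcrit
  have h0 : T.M p.1 = 0 := T.M_eq_zero_of_mem_H₂₃ p.2 hh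
  have hM : T.M p.1 = B.gFun p.1 + creaseσ T.ε (T.w p.1) := rfl
  have hσpos : 0 < creaseσ T.ε (T.w p.1) := by
    have h1 : (-T.ε) ∈ Ici (-T.ε) := self_mem_Ici
    have h2 : T.w p.1 ∈ Ici (-T.ε) := hw.le
    have := strictMonoOn_creaseσ T.ε_pos h1 h2 hw
    rwa [creaseσ_of_le_neg T.ε_pos le_rfl] at this
  have hG : B.gFun p.1 < 0 := by linarith
  have hGdef : B.gFun p.1 = B.g (B.lamLift p.1) - B.b := rfl
  have hglt : B.g (B.lamLift p.1) < B.b := by linarith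
  have hgap := 𝔉.critgap (B.lamLift p.1) hcg hglt
  have hσ2 : 2 * T.ε ≤ creaseσ T.ε (T.w p.1) := by linarith
  have hwε : T.ε ≤ T.w p.1 := by
    have hle := creaseσ_le T.ε_pos (T.w p.1)
    rcases le_total (T.w p.1) 0 with h | h
    · rw [max_eq_right h] at hle; linarith
    · rw [max_eq_left h] at hle; linarith
  refine ⟨?_, hwε⟩
  have := T.M_eq_sub_of_le_w hwε
  rw [h0] at this
  linarith

/-- **Over a critical point of `g`, on the flat lid, `F_lin` is critical on `X`** (`D(G ∘ e⁻¹) = 0`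
and `α' = 0` there). [cite: GayKirby2016, §4, Lemma 14] -/
theorem isMCriticalPt_Flin {x : X} (hh : B.Hit x) (hcg : IsMCriticalPt (𝓡 3) B.g (B.lamLift x))
    (hfc : B.f x = T.c) : IsMCriticalPt (𝓡 4) 𝔓.Flin x := by
  set e := chartAt (EuclideanSpace ℝ (Fin 4)) x with hedef
  have he : e ∈ IsManifold.maximalAtlas (𝓡 4) ∞ X := IsManifold.chart_mem_maximalAtlas x
  have he2 : e ∈ IsManifold.maximalAtlas (𝓡 4) 2 X := IsManifold.maximalAtlas_subset_of_le (by norm_cast) he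
  have hxe : x ∈ e.source := mem_chart_source _ x
  have hGcrit : IsMCriticalPt (𝓡 4) B.gFun x := (B.isMCriticalPt_gFun_iff T.Fr hh).2 hcg
  have hG0 : fderiv ℝ (B.gFun ∘ e.symm) (e x) = 0 := by
    have := (isMCriticalPt_iff_fderiv_comp_extend_symm_eq_zero ((T.Fr.contMDiffAt_gFun hh).of_le (by norm_cast)) he2 hxe).1 hGcrit
    simpa [OpenPartialHomeomorph.extend_coe, OpenPartialHomeomorph.extend_coe_symm] using this
  have hα'0 : deriv T.alpha (B.f x - B.a) = 0 := by
    apply T.deriv_alpha_of_ge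
    rw [hfc]
    have := T.ε_pos
    unfold αS ασ; linarith
  rw [isMCriticalPt_iff_fderiv_comp_extend_symm_eq_zero ((𝔓.contMDiffAt_Flin hh).of_le (by norm_cast)) he2 hxe]
  have hF0 : fderiv ℝ (𝔓.Flin ∘ e.symm) (e x) = 0 := by
    ext v
    rw [𝔓.fderiv_Flin_comp_symm_apply he hxe hh v, hα'0, hG0]
    simp
  simpa [OpenPartialHomeomorph.extend_coe, OpenPartialHomeomorph.extend_coe_symm] using hF0

/-- **Over a critical point of `g`, on the flat lid and off the core zones, `F` is critical on `X`.** [cite: GayKirby2016, §4, Lemma 14] -/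
theorem isMCriticalPt_Famb {x : X} (hH : x ∈ T.H₂₃) (hx₁ : x ∉ T.X₁) (hz : ∀ j, x ∉ 𝔓.zone j) (hh : B.Hit x)
    (hcg : IsMCriticalPt (𝓡 3) B.g (B.lamLift x)) (hfc : B.f x = T.c) : IsMCriticalPt (𝓡 4) 𝔓.Famb x := by
  have h := 𝔓.isMCriticalPt_Flin hh hcg hfc
  unfold IsMCriticalPt at h ⊢
  rwa [(𝔓.Famb_eventuallyEq_Flin hH hx₁ hz).mfderiv_eq]

include hc2 in
/-- **Conversely, the lid point over a critical point of `g` is critical for `F_H`** (off the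
core zones, on the flat lid `F` is critical on `X`). [cite: GayKirby2016, §4, Lemma 14] -/
theorem isMCriticalPt_FH_of_isMCriticalPt_g {p : T.H₂₃}
    (hps : p.1 ∉ B.surface) (hh : B.Hit p.1) (hz : ∀ j, p.1 ∉ 𝔓.zone j)
    (hcg : IsMCriticalPt (𝓡 3) B.g (B.lamLift p.1)) (hfc : B.f p.1 = T.c) :
    letI := (T.bsliceAtlas hc2 𝔉.two_mul_ε_le 𝔉.linkCondition).chartedSpace
    IsMCriticalPt (𝓡∂ 3) 𝔓.FH p := by
  letI := (T.bsliceAtlas hc2 𝔉.two_mul_ε_le 𝔉.linkCondition).chartedSpace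
  set Φ := T.bsliceAtlas hc2 𝔉.two_mul_ε_le 𝔉.linkCondition with hΦ
  have hp₁ : p.1 ∉ T.X₁ := fun h1 => hps (by rw [← T.H₂₃_inter_X₁ hc2]; exact ⟨p.2, h1⟩)
  have h0 : T.M p.1 = 0 := T.M_eq_zero_of_mem_H₂₃ p.2 hh
  have hint : (𝓡∂ 3).IsInteriorPoint p := by
    rw [ModelWithCorners.isInteriorPoint_iff_not_isBoundaryPoint,
      T.isBoundaryPoint_iff_mem_surface hc2 𝔉.two_mul_ε_le 𝔉.linkCondition p]
    exact hps
  have hψ := T.contMDiff_strFun hh h0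
  have hψc := T.not_isMCriticalPt_strFun hh h0
  have hO := T.isOpen_strDom hh h0
  have hpO := T.mem_strDom hh h0 hp₁
  have hS : ∀ q ∈ T.strDom hh h0, q ∈ T.H₂₃ ↔ T.strFun hh h0 q = T.strFun hh h0 p.1 := fun q hq =>
    T.mem_H₂₃_iff_of_mem_strDom hh h0 hq
  exact Φ.isMCriticalPt_comp_val_of_isMCriticalPt_of_localLevel hψ hψc hO hpO hS hint
    ((𝔓.contMDiffAt_Famb_of_mem_H₂₃ hc2 p.2).of_le (by norm_cast)) (𝔓.isMCriticalPt_Famb p.2 hp₁ hz hh hcg hfc)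

end BeltParams

end TubeFrame

end TriData

end BiCollar

end Literature.Topology.FourManifolds

end
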